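import Mathlib
import Summits.NavierStokesRegularity.NavierStokesRegularity.Theorems.FilamentSkeletonRssClause13LinearisedMap

/-!
# The linearised normal-velocity map `DT·Y` in CLOSED FORM on the tangency ball, FROM THE LITERAL CLAUSES of the crux
# `Clause13RNearStraightL` (stmt-NavierStokesRegularity-23612; line `rate_bordered_split`, both stubs `stub_rateRow13RFlat` / `stub_clamped13JBordered`)

Route `FilamentSkeletonRss`, Variant A1R.  Both registered stubs of the line `Cruxes/Clause13RNearStraightL/Lines/rate_bordered_split.lean` measure
an admissible variation `Y` through the opaque term `deriv (fun s => T (fun k σ => X k σ + s•Y k σ) j τ) 0` at IN-BALL stations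
`‖X_j τ‖ ≤ R_b√(Γ log Γ)`.  The landed `MatchedKernel.deriv_linearisedMap_tangent` (…Clause13LinearisedMap, p-lane 19175-p1 g12) turns this
`deriv` into the explicit integral operator
`W′ − ⟪W′, X_j′τ⟫X_j′τ + (w⟪X_j′τ, Y_j′τ⟫)X_j′τ − w Y_j′τ`, `W′ = Σ_k (Γγ_k/4π)∫ D_k σ dσ + ½Y_jτ − α e₃ × Y_jτ`,
under ANALYTIC side conditions (`C¹` curves with `‖X′‖ ≤ 1` and linear growth `c|σ| − C ≤ ‖X_k σ‖`, continuous cores with a floor, `C¹` test fields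
bounded together with their derivatives, exact tangency with unit tangent at the station).  This file DISCHARGES those side conditions from the crux's
clause block, verbatim, so that a clause-level proof of either stub can start from the closed form (dictionary step (c1)/(c5) of memo
`CENSUS-23610-side-23612-g16.md` §3, entry point):

* `linearGrowth_of_cone` — the cone clause 6 `c_g|τ − c_j| ≤ R_w√Γ + ‖X_j τ‖` gives `c_g|σ| − (R_w√Γ + c_g Σ_k|c_k|) ≤ ‖X_k σ‖`;
* `eq_zero_of_large_param` — with the off-ball clause `R_b√(Γ log Γ) < ‖X_j τ‖ → Y_j τ = 0`, every `Y_k` vanishes on `{σ : M < |σ|}`,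
  `M := Σ_k|c_k| + (R_w√Γ + R_b√(Γ log Γ))/c_g`, hence (`deriv_eq_zero_of_large_param`) so does `Y_k′`;
* `exists_uniform_bound` — therefore `C¹` test fields of the class are bounded with their derivatives by one constant `B ≥ 0` (compactness of
  `[-M, M]`);
* `deriv_linearisedMap_inBall` / `hasDerivAt_linearisedMap_inBall` — **the closed form at every in-ball station**, from: clause 3 (`C²`, unit
  speed), clause 6 (cone, `0 < c_g`), clause 8 (in-ball tangency `v(X_j τ) = w_j τ • X_j′τ` with `v y = u X y + ½y − α e₃ × y`), clause 13
  (differentiable cores) with the near-straight floor (iii) `Λ⁻¹ ≤ Aa`, and the test-class clauses (`C²`, zero off the ball); the slip value in the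
  formula is the crux's own `w_j τ`.

Hand `leafhand-ns-filamentskeletonrs-3-g0` (LAND-ONLY); `--supports stmt-NavierStokesRegularity-23612 --as helper`.  HONEST FRAMING: calculus bookkeeping
for a HYPOTHETICAL filament skeleton on the NEGATIVE side of a MODEL blow-up route; nothing here bears on Navier–Stokes regularity or blow-up, and
neither stub is proved here.
-/

noncomputable section

open scoped InnerProductSpace BigOperators Topology
open MeasureTheory Filter Metric Set
open Literature.Analysis.FluidPDE
open Summit.NavierStokesRegularity.NavierStokesRegularity.Theorems.MatchedKernel
  (deriv_linearisedMap_tangent linearisedMap_hasDerivAt_tangent)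

namespace Summit.NavierStokesRegularity.NavierStokesRegularity.Theorems.Clause13LinearisedMapClauses
set_option linter.dupNamespace false

/-! ## §1 Linear growth from the cone clause -/

/-- `|c_k| ≤ Σ_i |c_i|`. [folklore] -/
theorem abs_le_sum_abs {N : ℕ} (c : Fin N → ℝ) (k : Fin N) : |c k| ≤ ∑ i, |c i| :=
  Finset.single_le_sum (f := fun i => |c i|) (fun i _ => abs_nonneg (c i)) (Finset.mem_univ k)

/-- **Linear growth from the cone clause**: `c_g|τ − c_j| ≤ R_w√Γ + ‖X_j τ‖` for all `j, τ` implies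
`c_g|σ| − (R_w√Γ + c_g Σ_k|c_k|) ≤ ‖X_k σ‖` for all `k, σ` (the growth hypothesis of `deriv_linearisedMap_tangent`). [folklore] -/
theorem linearGrowth_of_cone {N : ℕ} {cg Rw Γ : ℝ} {X : Fin N → ℝ → EuclideanSpace ℝ (Fin 3)} {c : Fin N → ℝ} (hcg : 0 < cg)
    (hcone : ∀ j τ, cg * |τ - c j| ≤ Rw * Real.sqrt Γ + ‖X j τ‖) (k : Fin N) (σ : ℝ) :
    cg * |σ| - (Rw * Real.sqrt Γ + cg * ∑ i, |c i|) ≤ ‖X k σ‖ := by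
  have h1 := hcone k σ
  have h2 : |σ| ≤ |σ - c k| + |c k| := by
    have := abs_add_le (σ - c k) (c k); rwa [sub_add_cancel] at this
  have h3 := abs_le_sum_abs c k
  nlinarith [mul_le_mul_of_nonneg_left h2 hcg.le, mul_le_mul_of_nonneg_left h3 hcg.le]

/-! ## §2 Test fields vanish (with their derivatives) far out; a uniform bound -/

/-- Off-ball vanishing in the parameter: with `M := Σ_k|c_k| + (R_w√Γ + R_b√(Γ log Γ))/c_g`, every station `σ` with `M < |σ|` is off the
tangency ball of filament `k` (cone clause), so `Y_k σ = 0`. [folklore] -/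
theorem eq_zero_of_large_param {N : ℕ} {cg Rw Rb Γ : ℝ} {X Y : Fin N → ℝ → EuclideanSpace ℝ (Fin 3)} {c : Fin N → ℝ}
    (hcg : 0 < cg) (hcone : ∀ j τ, cg * |τ - c j| ≤ Rw * Real.sqrt Γ + ‖X j τ‖)
    (hYoff : ∀ j τ, Rb * Real.sqrt (Γ * Real.log Γ) < ‖X j τ‖ → Y j τ = 0) (k : Fin N) {σ : ℝ}
    (hσ : (∑ i, |c i|) + (Rw * Real.sqrt Γ + Rb * Real.sqrt (Γ * Real.log Γ)) / cg < |σ|) : Y k σ = 0 := by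
  apply hYoff k σ
  have hg := linearGrowth_of_cone hcg hcone k σ
  have h1 : (Rw * Real.sqrt Γ + Rb * Real.sqrt (Γ * Real.log Γ)) / cg < |σ| - ∑ i, |c i| := by linarith
  rw [div_lt_iff₀ hcg] at h1
  nlinarith

/-- … hence `Y_k′ σ = 0` there as well (the zero set `{M < |σ|}` is open). [folklore] -/
theorem deriv_eq_zero_of_large_param {N : ℕ} {cg Rw Rb Γ : ℝ} {X Y : Fin N → ℝ → EuclideanSpace ℝ (Fin 3)} {c : Fin N → ℝ}
    (hcg : 0 < cg) (hcone : ∀ j τ, cg * |τ - c j| ≤ Rw * Real.sqrt Γ + ‖X j τ‖)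
    (hYoff : ∀ j τ, Rb * Real.sqrt (Γ * Real.log Γ) < ‖X j τ‖ → Y j τ = 0) (k : Fin N) {σ : ℝ}
    (hσ : (∑ i, |c i|) + (Rw * Real.sqrt Γ + Rb * Real.sqrt (Γ * Real.log Γ)) / cg < |σ|) : deriv (Y k) σ = 0 := by
  set M := (∑ i, |c i|) + (Rw * Real.sqrt Γ + Rb * Real.sqrt (Γ * Real.log Γ)) / cg with hM
  have hopen : IsOpen {s : ℝ | M < |s|} := isOpen_lt continuous_const continuous_abs
  have hev : (Y k) =ᶠ[𝓝 σ] fun _ => (0 : EuclideanSpace ℝ (Fin 3)) := by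
    filter_upwards [hopen.mem_nhds hσ] with s hs
    exact eq_zero_of_large_param hcg hcone hYoff k hs
  rw [hev.deriv_eq, deriv_const]

/-- **Uniform bound for the test class**: `C¹` fields that vanish off the tangency balls are bounded, together with their derivatives, by
one constant `B ≥ 0` (continuity on the compact parameter window `[-M, M]`, zero outside). [folklore] -/
theorem exists_uniform_bound {N : ℕ} {cg Rw Rb Γ : ℝ} {X Y : Fin N → ℝ → EuclideanSpace ℝ (Fin 3)} {c : Fin N → ℝ}
    (hcg : 0 < cg) (hcone : ∀ j τ, cg * |τ - c j| ≤ Rw * Real.sqrt Γ + ‖X j τ‖)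
    (hYoff : ∀ j τ, Rb * Real.sqrt (Γ * Real.log Γ) < ‖X j τ‖ → Y j τ = 0) (hY : ∀ k, ContDiff ℝ 1 (Y k)) :
    ∃ B : ℝ, 0 ≤ B ∧ (∀ k σ, ‖Y k σ‖ ≤ B) ∧ (∀ k σ, ‖deriv (Y k) σ‖ ≤ B) := by
  set M := (∑ i, |c i|) + (Rw * Real.sqrt Γ + Rb * Real.sqrt (Γ * Real.log Γ)) / cg with hM
  have hK : IsCompact (Icc (-M) M) := isCompact_Icc
  -- per-filament bounds on the window
  have hb : ∀ k, ∃ Bk : ℝ, ∀ σ ∈ Icc (-M) M, ‖Y k σ‖ ≤ Bk := fun k =>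
    hK.exists_bound_of_continuousOn (hY k).continuous.continuousOn
  have hb' : ∀ k, ∃ Bk : ℝ, ∀ σ ∈ Icc (-M) M, ‖deriv (Y k) σ‖ ≤ Bk := fun k =>
    hK.exists_bound_of_continuousOn ((hY k).continuous_deriv le_rfl).continuousOn
  choose B1 hB1 using hb
  choose B2 hB2 using hb'
  refine ⟨∑ k, (|B1 k| + |B2 k|), Finset.sum_nonneg fun k _ => by positivity, fun k σ => ?_, fun k σ => ?_⟩
  · have hle : |B1 k| + |B2 k| ≤ ∑ i, (|B1 i| + |B2 i|) :=
      Finset.single_le_sum (f := fun i => |B1 i| + |B2 i|) (fun i _ => by positivity) (Finset.mem_univ k)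
    by_cases hσ : σ ∈ Icc (-M) M
    · exact le_trans (le_trans (hB1 k σ hσ) (le_abs_self _)) (by linarith [abs_nonneg (B2 k)])
    · have hσ' : M < |σ| := by
        rw [mem_Icc, not_and_or, not_le, not_le] at hσ
        rcases hσ with h | h
        · exact lt_of_lt_of_le (by linarith) (neg_le_abs σ)
        · exact lt_of_lt_of_le h (le_abs_self σ)
      rw [eq_zero_of_large_param hcg hcone hYoff k hσ', norm_zero]
      linarith [abs_nonneg (B1 k), abs_nonneg (B2 k)]
  · have hle : |B1 k| + |B2 k| ≤ ∑ i, (|B1 i| + |B2 i|) :=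
      Finset.single_le_sum (f := fun i => |B1 i| + |B2 i|) (fun i _ => by positivity) (Finset.mem_univ k)
    by_cases hσ : σ ∈ Icc (-M) M
    · exact le_trans (le_trans (hB2 k σ hσ) (le_abs_self _)) (by linarith [abs_nonneg (B1 k)])
    · have hσ' : M < |σ| := by
        rw [mem_Icc, not_and_or, not_le, not_le] at hσ
        rcases hσ with h | h
        · exact lt_of_lt_of_le (by linarith) (neg_le_abs σ)
        · exact lt_of_lt_of_le h (le_abs_self σ)
      rw [deriv_eq_zero_of_large_param hcg hcone hYoff k hσ', norm_zero]
      linarith [abs_nonneg (B1 k), abs_nonneg (B2 k)]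

/-! ## §3 The closed form of `DT·Y` at every in-ball station, from the clauses -/

/-- **`DT·Y` HAS THE CLOSED-FORM DERIVATIVE AT EVERY IN-BALL STATION, FROM THE CRUX'S CLAUSES.**  Hypotheses, all verbatim clause texts or
their conjuncts: the binders `hu`, `hv`, `hT` of the crux; clause 3 (`C²` axes, unit speed); clause 6 (cone) with `0 < c_g`; clause 8 (in-ball
tangency); differentiable cores (clause 13) with a positive floor `A₀ ≤ Aa` (near-straight (iii) with `A₀ = Λ⁻¹`); test fields `C²` and zero off
the ball.  Conclusion: `linearisedMap_hasDerivAt_tangent`'s closed form with slip `w_j τ`. [folklore] -/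
theorem hasDerivAt_linearisedMap_inBall {N : ℕ} {Γ α Rb Rw cg A₀ : ℝ} {γ : Fin N → ℝ}
    {X Y : Fin N → ℝ → EuclideanSpace ℝ (Fin 3)} {w : Fin N → ℝ → ℝ} {c : Fin N → ℝ} {Aa : Fin N → ℝ → ℝ}
    {u : (Fin N → ℝ → EuclideanSpace ℝ (Fin 3)) → EuclideanSpace ℝ (Fin 3) → EuclideanSpace ℝ (Fin 3)}
    {v : EuclideanSpace ℝ (Fin 3) → EuclideanSpace ℝ (Fin 3)}
    {T : (Fin N → ℝ → EuclideanSpace ℝ (Fin 3)) → Fin N → ℝ → EuclideanSpace ℝ (Fin 3)}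
    (hu : ∀ Z y, u Z y = ∑ k, (Γ * γ k / (4 * Real.pi)) • ∫ σ : ℝ,
      ((‖y - Z k σ‖ ^ 2 + Real.exp (-(1 + Real.eulerMascheroniConstant - Real.log 2)) * Aa k σ) ^ (3 / 2 : ℝ))⁻¹ •
        cross (deriv (Z k) σ) (y - Z k σ))
    (hv : ∀ y, v y = u X y + (1 / 2 : ℝ) • y - α • cross (EuclideanSpace.single 2 1) y)
    (hT : ∀ Z j τ, T Z j τ = (u Z (Z j τ) + (1 / 2 : ℝ) • Z j τ - α • cross (EuclideanSpace.single 2 1) (Z j τ))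
      - (⟪u Z (Z j τ) + (1 / 2 : ℝ) • Z j τ - α • cross (EuclideanSpace.single 2 1) (Z j τ), deriv (Z j) τ⟫_ℝ
          / ‖deriv (Z j) τ‖ ^ 2) • deriv (Z j) τ)
    (hX2 : ∀ k, ContDiff ℝ 2 (X k)) (hunit : ∀ k σ, ‖deriv (X k) σ‖ = 1)
    (hcg : 0 < cg) (hcone : ∀ j τ, cg * |τ - c j| ≤ Rw * Real.sqrt Γ + ‖X j τ‖)
    (htan : ∀ j τ, ‖X j τ‖ ≤ Rb * Real.sqrt (Γ * Real.log Γ) → v (X j τ) = w j τ • deriv (X j) τ)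
    (hAd : ∀ k, Differentiable ℝ (Aa k)) (hA₀ : 0 < A₀) (hAfl : ∀ k σ, A₀ ≤ Aa k σ)
    (hY2 : ∀ k, ContDiff ℝ 2 (Y k)) (hYoff : ∀ j τ, Rb * Real.sqrt (Γ * Real.log Γ) < ‖X j τ‖ → Y j τ = 0)
    (j : Fin N) (τ : ℝ) (hin : ‖X j τ‖ ≤ Rb * Real.sqrt (Γ * Real.log Γ)) :
    HasDerivAt (fun s : ℝ => T (fun k σ => X k σ + s • Y k σ) j τ)
      (((∑ k, (Γ * γ k / (4 * Real.pi)) • ∫ σ : ℝ,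
          ((-3 * ⟪X j τ - X k σ, Y j τ - Y k σ⟫_ℝ *
              ((‖X j τ - X k σ‖ ^ 2 + Real.exp (-(1 + Real.eulerMascheroniConstant - Real.log 2)) * Aa k σ) ^ (5 / 2 : ℝ))⁻¹) •
            cross (deriv (X k) σ) (X j τ - X k σ) +
          ((‖X j τ - X k σ‖ ^ 2 + Real.exp (-(1 + Real.eulerMascheroniConstant - Real.log 2)) * Aa k σ) ^ (3 / 2 : ℝ))⁻¹ •
            (cross (deriv (X k) σ) (Y j τ - Y k σ) + cross (deriv (Y k) σ) (X j τ - X k σ))))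
        + (1 / 2 : ℝ) • Y j τ - α • cross (EuclideanSpace.single 2 1) (Y j τ))
       - ⟪((∑ k, (Γ * γ k / (4 * Real.pi)) • ∫ σ : ℝ,
          ((-3 * ⟪X j τ - X k σ, Y j τ - Y k σ⟫_ℝ *
              ((‖X j τ - X k σ‖ ^ 2 + Real.exp (-(1 + Real.eulerMascheroniConstant - Real.log 2)) * Aa k σ) ^ (5 / 2 : ℝ))⁻¹) •
            cross (deriv (X k) σ) (X j τ - X k σ) +
          ((‖X j τ - X k σ‖ ^ 2 + Real.exp (-(1 + Real.eulerMascheroniConstant - Real.log 2)) * Aa k σ) ^ (3 / 2 : ℝ))⁻¹ •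
            (cross (deriv (X k) σ) (Y j τ - Y k σ) + cross (deriv (Y k) σ) (X j τ - X k σ))))
        + (1 / 2 : ℝ) • Y j τ - α • cross (EuclideanSpace.single 2 1) (Y j τ)), deriv (X j) τ⟫_ℝ • deriv (X j) τ
       + (w j τ * ⟪deriv (X j) τ, deriv (Y j) τ⟫_ℝ) • deriv (X j) τ - w j τ • deriv (Y j) τ) 0 := by
  obtain ⟨B, hB, hYb, hY'b⟩ := exists_uniform_bound hcg hcone hYoff (fun k => (hY2 k).of_le (by norm_num))
  have htanj : u X (X j τ) + (1 / 2 : ℝ) • X j τ - α • cross (EuclideanSpace.single 2 1) (X j τ) = w j τ • deriv (X j) τ := by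
    rw [← hv]; exact htan j τ hin
  exact linearisedMap_hasDerivAt_tangent hu hT hcg (fun k => (hX2 k).of_le (by norm_num)) (fun k σ => (hunit k σ).le)
    (fun k σ => linearGrowth_of_cone hcg hcone k σ) (fun k => (hAd k).continuous) hA₀ hAfl
    (fun k => (hY2 k).of_le (by norm_num)) hB hYb hY'b j τ (w j τ) (hunit j τ) htanj

/-- **COROLLARY: the `deriv` that both stubs measure, in closed form at every in-ball station, from the clauses.** [folklore] -/
theorem deriv_linearisedMap_inBall {N : ℕ} {Γ α Rb Rw cg A₀ : ℝ} {γ : Fin N → ℝ}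
    {X Y : Fin N → ℝ → EuclideanSpace ℝ (Fin 3)} {w : Fin N → ℝ → ℝ} {c : Fin N → ℝ} {Aa : Fin N → ℝ → ℝ}
    {u : (Fin N → ℝ → EuclideanSpace ℝ (Fin 3)) → EuclideanSpace ℝ (Fin 3) → EuclideanSpace ℝ (Fin 3)}
    {v : EuclideanSpace ℝ (Fin 3) → EuclideanSpace ℝ (Fin 3)}
    {T : (Fin N → ℝ → EuclideanSpace ℝ (Fin 3)) → Fin N → ℝ → EuclideanSpace ℝ (Fin 3)}
    (hu : ∀ Z y, u Z y = ∑ k, (Γ * γ k / (4 * Real.pi)) • ∫ σ : ℝ,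
      ((‖y - Z k σ‖ ^ 2 + Real.exp (-(1 + Real.eulerMascheroniConstant - Real.log 2)) * Aa k σ) ^ (3 / 2 : ℝ))⁻¹ •
        cross (deriv (Z k) σ) (y - Z k σ))
    (hv : ∀ y, v y = u X y + (1 / 2 : ℝ) • y - α • cross (EuclideanSpace.single 2 1) y)
    (hT : ∀ Z j τ, T Z j τ = (u Z (Z j τ) + (1 / 2 : ℝ) • Z j τ - α • cross (EuclideanSpace.single 2 1) (Z j τ))
      - (⟪u Z (Z j τ) + (1 / 2 : ℝ) • Z j τ - α • cross (EuclideanSpace.single 2 1) (Z j τ), deriv (Z j) τ⟫_ℝ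
          / ‖deriv (Z j) τ‖ ^ 2) • deriv (Z j) τ)
    (hX2 : ∀ k, ContDiff ℝ 2 (X k)) (hunit : ∀ k σ, ‖deriv (X k) σ‖ = 1)
    (hcg : 0 < cg) (hcone : ∀ j τ, cg * |τ - c j| ≤ Rw * Real.sqrt Γ + ‖X j τ‖)
    (htan : ∀ j τ, ‖X j τ‖ ≤ Rb * Real.sqrt (Γ * Real.log Γ) → v (X j τ) = w j τ • deriv (X j) τ)
    (hAd : ∀ k, Differentiable ℝ (Aa k)) (hA₀ : 0 < A₀) (hAfl : ∀ k σ, A₀ ≤ Aa k σ)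
    (hY2 : ∀ k, ContDiff ℝ 2 (Y k)) (hYoff : ∀ j τ, Rb * Real.sqrt (Γ * Real.log Γ) < ‖X j τ‖ → Y j τ = 0)
    (j : Fin N) (τ : ℝ) (hin : ‖X j τ‖ ≤ Rb * Real.sqrt (Γ * Real.log Γ)) :
    deriv (fun s : ℝ => T (fun k σ => X k σ + s • Y k σ) j τ) 0 =
      ((∑ k, (Γ * γ k / (4 * Real.pi)) • ∫ σ : ℝ,
          ((-3 * ⟪X j τ - X k σ, Y j τ - Y k σ⟫_ℝ *
              ((‖X j τ - X k σ‖ ^ 2 + Real.exp (-(1 + Real.eulerMascheroniConstant - Real.log 2)) * Aa k σ) ^ (5 / 2 : ℝ))⁻¹) •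
            cross (deriv (X k) σ) (X j τ - X k σ) +
          ((‖X j τ - X k σ‖ ^ 2 + Real.exp (-(1 + Real.eulerMascheroniConstant - Real.log 2)) * Aa k σ) ^ (3 / 2 : ℝ))⁻¹ •
            (cross (deriv (X k) σ) (Y j τ - Y k σ) + cross (deriv (Y k) σ) (X j τ - X k σ))))
        + (1 / 2 : ℝ) • Y j τ - α • cross (EuclideanSpace.single 2 1) (Y j τ))
       - ⟪((∑ k, (Γ * γ k / (4 * Real.pi)) • ∫ σ : ℝ,
          ((-3 * ⟪X j τ - X k σ, Y j τ - Y k σ⟫_ℝ *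
              ((‖X j τ - X k σ‖ ^ 2 + Real.exp (-(1 + Real.eulerMascheroniConstant - Real.log 2)) * Aa k σ) ^ (5 / 2 : ℝ))⁻¹) •
            cross (deriv (X k) σ) (X j τ - X k σ) +
          ((‖X j τ - X k σ‖ ^ 2 + Real.exp (-(1 + Real.eulerMascheroniConstant - Real.log 2)) * Aa k σ) ^ (3 / 2 : ℝ))⁻¹ •
            (cross (deriv (X k) σ) (Y j τ - Y k σ) + cross (deriv (Y k) σ) (X j τ - X k σ))))
        + (1 / 2 : ℝ) • Y j τ - α • cross (EuclideanSpace.single 2 1) (Y j τ)), deriv (X j) τ⟫_ℝ • deriv (X j) τ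
       + (w j τ * ⟪deriv (X j) τ, deriv (Y j) τ⟫_ℝ) • deriv (X j) τ - w j τ • deriv (Y j) τ :=
  (hasDerivAt_linearisedMap_inBall hu hv hT hX2 hunit hcg hcone htan hAd hA₀ hAfl hY2 hYoff j τ hin).deriv

end Summit.NavierStokesRegularity.NavierStokesRegularity.Theorems.Clause13LinearisedMapClauses

end
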